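import Mathlib.Geometry.Manifold.MFDeriv.Atlas
import Literature.Geometry.Lorentzian.Geodesic
import HarnessLib

/-!
# Velocity of chart-straight curves (discharge of `velocity_curveThrough_zero`)

This file discharges the named fact `Literature.Geometry.Lorentzian.velocity_curveThrough_zero` of
`Literature.Geometry.Lorentzian.Geodesic`: at an interior point `x` of a `C¹` real manifold `M`
(model `I : ModelWithCorners ℝ E H`), the **chart-straight curve**
`curveThrough I x v = (t ↦ φ⁻¹(φ x + t v))`, `φ = extChartAt I x`, has velocity `v` at `t = 0`
(`velocity_curveThrough_zero_holds`). This is how every tangent vector is realised as the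
velocity of a curve (O'Neill 1983, Ch. 1, Exercise 5), which the geodesic files use to state
initial-value problems.

## The printed argument and its formalisation

O'Neill, Ch. 1, Def. 17: the velocity of a curve `α : I → M` at `t` is `α'(t) = dα(d/du|ₜ)`, with
(2) the coordinate expression `α'(t) = ∑ᵢ d(xⁱ ∘ α)/du (t) ∂ᵢ|_{α(t)}` and (4) `dφ(α'(t)) =
(φ ∘ α)'(t)` (from the chain rule, Lemma 15); Def. 45 and Lemma 46: in a vector space the curve
`α(t) = p + tv` has `α'(0) = v_p = ∑ xⁱ(v) ∂ᵢ|ₚ`, "the tangent vector at `p` with the same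
coordinates as `v`"; Exercise 5: "Given `v ∈ T_p(M)`, there is … a curve `α` such that
`α'(0) = v`." For `γ = φ⁻¹ ∘ α` with `α(t) = φ x + t v` the coordinate functions
`xⁱ ∘ γ = xⁱ(x) + t vⁱ` are affine, so (2) gives `γ'(0) = v`. In Mathlib terms: the straight line
`α` has manifold derivative `t ↦ t v` (`hasMFDerivAt_lineThrough`, from the Fréchet derivative);
`φ⁻¹ = (extChartAt I x).symm` is differentiable within `range I` at `φ x`
(`mdifferentiableWithinAt_extChartAt_symm`) with derivative the identity when read in the chart
`φ` (`mfderivWithin_range_extChartAt_symm`); at an *interior* point `range I` is a neighbourhood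
of `φ x` (`range_mem_nhds_isInteriorPoint`), so these are genuine derivatives, and the chain rule
(`mfderiv_comp_apply_of_eq`) gives `γ'(0) = id (1 • v) = v`. Interiority is used: at a boundary
point of a manifold with corners the values of `I.symm` outside `range I` enter, and the two-sided
derivative of `γ` at `0` need not be `v`.

The docstring of the fact in `Geodesic` points to "O'Neill 1983, Ch. 1, Prop. 1.16"; in O'Neill,
1.16 is the inverse function theorem (Thm. 16), and the locators carrying the statement are the
ones above (Def. 17 (2), Lemma 46, Exercise 5).

## References

* B. O'Neill, *Semi-Riemannian geometry with applications to relativity*, Academic Press 1983,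
  Ch. 1: Lemma 15 (chain rule), Def. 17 (velocity vector; (2) coordinate expression, (4) effect of
  a mapping), Def. 45 and Lemma 46 (`v_p = α'(0)` for `α(t) = p + tv`), Exercise 5 (every
  `v ∈ T_p M` is the velocity of a curve).
-/

noncomputable section

open Set
open scoped Manifold Topology

namespace Literature.Geometry.Lorentzian

variable {E : Type*} [NormedAddCommGroup E] [NormedSpace ℝ E] {H : Type*} [TopologicalSpace H]
  {I : ModelWithCorners ℝ E H} {M : Type*} [TopologicalSpace M] [ChartedSpace H M]

/-- The straight line `t ↦ p + t w` in the model vector space `E` has (manifold) derivative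
`t ↦ t w` at every parameter `t₀`. O'Neill 1983, Ch. 1, Def. 45 and Lemma 46 (`v_p = α'(0)` for
`α(t) = p + tv`, "the tangent vector at `p` with the same coordinates as `v`").
[cite: ONeill1983, Ch. 1, Def. 45 and Lemma 46] -/
theorem hasMFDerivAt_lineThrough (p w : E) (t₀ : ℝ) :
    HasMFDerivAt 𝓘(ℝ, ℝ) 𝓘(ℝ, E) (fun t : ℝ ↦ p + t • w) t₀
      ((ContinuousLinearMap.id ℝ ℝ).smulRight w) :=
  (((hasFDerivAt_id t₀).smul_const w).const_add p).hasMFDerivAt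

/-- **The chart-straight curve has the prescribed velocity** (discharge of the named fact
`velocity_curveThrough_zero`). At an interior point `x`, the curve `γ(t) = φ⁻¹(φ x + t v)`
(`φ = extChartAt I x`, `γ = curveThrough I x v`) has velocity `γ'(0) = v`. By the chain rule
(O'Neill 1983, Ch. 1, Lemma 15 and Def. 17 (4)), `γ'(0) = d(φ⁻¹)_{φ x}(α'(0))` for the straight
line `α(t) = φ x + t v` of `E`, whose velocity is `v` (Ch. 1, Def. 45 and Lemma 46,
`hasMFDerivAt_lineThrough`); and `d(φ⁻¹)_{φ x}` read in the chart `φ` is the identity (Mathlib's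
`mfderivWithin_range_extChartAt_symm`; at an interior point `range I` is a neighbourhood of `φ x`,
so the derivative within `range I` is the derivative, and `φ⁻¹` is differentiable there,
`mdifferentiableWithinAt_extChartAt_symm`). This is the coordinate expression of the velocity,
O'Neill 1983, Ch. 1, Def. 17 (2), `α'(t) = ∑ᵢ d(xⁱ ∘ α)/du (t) ∂ᵢ`, for the curve whose coordinate
functions `xⁱ ∘ γ = xⁱ(x) + t vⁱ` are affine, and it is the solution of Ch. 1, Exercise 5 (every
`v ∈ T_p M` is `α'(0)` for some curve `α`). Only `C¹` charts (`IsManifold I 1 M`, a binder of the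
fact) and interiority of `x` are used. [cite: ONeill1983, Ch. 1, Def. 17 (2), Lemma 46 and Exercise 5] -/
theorem velocity_curveThrough_zero_holds : velocity_curveThrough_zero (I := I) (M := M) := by
  intro _ x hx v
  have hnhds : range I ∈ 𝓝 (extChartAt I x x) := range_mem_nhds_isInteriorPoint hx
  have hφ : MDifferentiableAt 𝓘(ℝ, E) I (extChartAt I x).symm (extChartAt I x x) :=
    (mdifferentiableWithinAt_extChartAt_symm (mem_extChartAt_target x)).mdifferentiableAt hnhds
  have hL := hasMFDerivAt_lineThrough (extChartAt I x x) (show E from v) 0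
  -- chain rule for `γ = φ⁻¹ ∘ α` at `t = 0`, evaluated on the unit vector `1 ∈ T_0 ℝ`
  have h := mfderiv_comp_apply_of_eq (hg := hφ) (hf := hL.mdifferentiableAt) (hy := by simp)
    (v := (1 : ℝ))
  rw [hL.mfderiv, ← mfderivWithin_of_mem_nhds hnhds, mfderivWithin_range_extChartAt_symm] at h
  -- `h` now reads `γ'(0) = id ((t ↦ t v) 1)`, definitionally `γ'(0) = 1 • v`
  have h' : velocity I (curveThrough I x v) 0 = (1 : ℝ) • (show E from v) := h
  rw [h']
  exact one_smul ℝ _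

end Literature.Geometry.Lorentzian

end
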